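import Literature.MathematicalPhysics.QuantumFieldTheory.OSSemigroupAveraging
import Literature.MathematicalPhysics.QuantumLattice.SchwartzTranslationCutoff
import Literature.Analysis.FunctionSpaces.SchwartzParametric
import HarnessLib

/-!
# Skeleton clusters: tensor products of one-point test functions at prescribed times

Topic `Literature/MathematicalPhysics/QuantumFieldTheory`; bookkeeping for the analytic
continuation of the Schwinger functions in several time variables (Osterwalder–Schrader II,
Comm. Math. Phys. 42 (1975), Ch. V, Method A: "treat the spatial variables as distributional
variables throughout … `S_{n-1}(ξ⁰ | f)`", p. 290). The several-variable continuation is obtained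
(in the sequel files) by superposing, over the time differences, the values of `𝔖ₖ` on
**skeleton clusters**: a fixed `K`-point test function `Φ₀` (in practice a tensor product
`φ₀ ⊗ ⋯ ⊗ φ_{K-1}` of one-point functions, each a short time profile times a spatial test
function) translated point by point to prescribed *skeleton times* `a = (a₀, …, a_{K-1})`,

  `skeletonFn Φ₀ a (x) = Φ₀(x₀ - a₀ e₀, …, x_{K-1} - a_{K-1} e₀)`.

This file provides:

* `timeShift a` — the configuration `(a_j e₀)_j`, `‖timeShift a‖ = max |a_j|`;
  `skeletonFn Φ₀ a = compSubConstCLM (timeShift a) Φ₀`, its values, its continuity and the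
  **polynomial growth of its Schwartz seminorms in `a`** (`seminorm_skeletonFn_le`), joint time
  translation `(skeletonFn Φ₀ a)_c = skeletonFn Φ₀ (a + c)`;
* for tensor products `Φ₀ = tensorFin φ`: the **splitting** over `K = n + m` into an appended
  tensor product of the two sub-clusters (`skeletonFn_tensorFin_add`), the **OS adjoint** of a
  skeleton cluster (`osAdjoint_skeletonFn_tensorFin`: reversed order, reflected one-point
  functions, negated times), and **positivity in time** when the profiles are short and the
  skeleton times large (`isPositiveTimeMulti_skeletonFn_tensorFin`);
* the **pairing identity** (`schwinger_skeletonFn_eq_genPairing`): if the first `n` skeleton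
  times are `≤ -r` and the last `m` are `≥ r + t` (`t ≥ 0`), where `r` bounds the time supports
  of the profiles, then `𝔖_{n+m}(skeletonFn (tensorFin φ) a) = 𝔖(ΘP* ⊗ R_t)` with the
  positive-time generators `P` (the OS adjoint of the left sub-cluster) and `R` (the right
  sub-cluster pulled back by `t`) — the form to which the holomorphic semigroup applies
  (`SchwingerFamily.gapContinuation`).

## References

* K. Osterwalder, R. Schrader, *Axioms for Euclidean Green's functions II*, Comm. Math. Phys.
  42 (1975) 281–305, Ch. V p. 290 (Method A), (5.1)–(5.4). [OsterwalderSchraderCMP1975]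
* K. Osterwalder, R. Schrader, *Axioms for Euclidean Green's functions*, Comm. Math. Phys. 31
  (1973), §4.1. [OsterwalderSchraderCMP1973]
-/

noncomputable section

open MeasureTheory Set Filter
open _root_.Topology
open scoped InnerProductSpace NNReal ComplexConjugate SchwartzMap

namespace Literature.MathematicalPhysics.QuantumFieldTheory

variable {d : ℕ} [NeZero d]

open Literature.MathematicalPhysics.QuantumLattice (SchwingerFamily IsPositiveTimeMulti)
open Literature.MathematicalPhysics.QuantumLattice.SchwingerFamily

/-! ### Time shifts of configurations -/

/-- The configuration `(a_j e₀)_j` of purely temporal vectors. [folklore] -/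
def timeShift {K : ℕ} (a : Fin K → ℝ) : Fin K → EuclideanSpace ℝ (Fin d) := fun j => timeVec (a j)

/-- Components of `timeShift`. [folklore] -/
@[simp] theorem timeShift_apply {K : ℕ} (a : Fin K → ℝ) (j : Fin K) :
    timeShift (d := d) a j = timeVec (a j) := rfl

/-- `timeShift` is additive. [folklore] -/
theorem timeShift_add {K : ℕ} (a b : Fin K → ℝ) :
    timeShift (d := d) (a + b) = timeShift a + timeShift b := by
  funext j; simp [timeShift, timeVec_add]

/-- A constant time shift is the diagonal configuration. [folklore] -/
theorem timeShift_const {K : ℕ} (c : ℝ) :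
    timeShift (d := d) (fun _ : Fin K => c) = fun _ => timeVec c := rfl

/-- `‖timeShift a‖ ≤ ‖a‖` (sup norms). [folklore] -/
theorem norm_timeShift_le {K : ℕ} (a : Fin K → ℝ) : ‖timeShift (d := d) a‖ ≤ ‖a‖ := by
  refine (pi_norm_le_iff_of_nonneg (norm_nonneg _)).2 fun j => ?_
  rw [timeShift_apply, timeVec, PiLp.norm_single]
  exact norm_le_pi_norm a j

/-- `timeShift` is continuous. [folklore] -/
theorem continuous_timeShift {K : ℕ} : Continuous (timeShift (d := d) (K := K)) :=
  continuous_pi fun j => (QuantumLattice.continuous_single_time d).comp (continuous_apply j)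

/-! ### Skeleton clusters -/

/-- The **skeleton cluster** `Φ₀(x₀ - a₀e₀, …, x_{K-1} - a_{K-1}e₀)`: the `K`-point test function
`Φ₀` with its points moved to the skeleton times `a`. [folklore] -/
def skeletonFn {K : ℕ} (Φ₀ : 𝓢((Fin K → EuclideanSpace ℝ (Fin d)), ℂ)) (a : Fin K → ℝ) :
    𝓢((Fin K → EuclideanSpace ℝ (Fin d)), ℂ) :=
  SchwartzMap.compSubConstCLM ℂ (timeShift a) Φ₀

/-- Values of a skeleton cluster. [folklore] -/
@[simp] theorem skeletonFn_apply {K : ℕ} (Φ₀ : 𝓢((Fin K → EuclideanSpace ℝ (Fin d)), ℂ))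
    (a : Fin K → ℝ) (x : Fin K → EuclideanSpace ℝ (Fin d)) :
    skeletonFn Φ₀ a x = Φ₀ (fun j => x j - timeVec (a j)) := rfl

/-- `skeletonFn Φ₀ 0 = Φ₀`. [folklore] -/
theorem skeletonFn_zero {K : ℕ} (Φ₀ : 𝓢((Fin K → EuclideanSpace ℝ (Fin d)), ℂ)) :
    skeletonFn Φ₀ 0 = Φ₀ := by
  ext x; simp [timeVec_zero]

/-- **Continuity of the skeleton cluster in the skeleton times.** [folklore] -/
theorem continuous_skeletonFn {K : ℕ} (Φ₀ : 𝓢((Fin K → EuclideanSpace ℝ (Fin d)), ℂ)) :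
    Continuous (skeletonFn Φ₀) :=
  (QuantumLattice.continuous_compSubConstCLM (𝕜 := ℂ) Φ₀).comp continuous_timeShift

/-- **Polynomial growth of the Schwartz seminorms of a skeleton cluster**:
`p_{k,n}(skeletonFn Φ₀ a) ≤ 2ᵏ (1 + ‖a‖)ᵏ (p_{k,n}(Φ₀) + p_{0,n}(Φ₀))`. [folklore] -/
theorem seminorm_skeletonFn_le {K : ℕ} (Φ₀ : 𝓢((Fin K → EuclideanSpace ℝ (Fin d)), ℂ))
    (k n : ℕ) (a : Fin K → ℝ) :
    SchwartzMap.seminorm ℂ k n (skeletonFn Φ₀ a) ≤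
      2 ^ k * (1 + ‖a‖) ^ k * (SchwartzMap.seminorm ℂ k n Φ₀ + SchwartzMap.seminorm ℂ 0 n Φ₀) := by
  refine (SchwartzMap.seminorm_compSubConstCLM_le Φ₀ k n _).trans ?_
  have h0 : 0 ≤ SchwartzMap.seminorm ℂ k n Φ₀ + SchwartzMap.seminorm ℂ 0 n Φ₀ := by positivity
  gcongr
  exact norm_timeShift_le a

/-- **Joint time translation of a skeleton cluster** shifts all skeleton times:
`(skeletonFn Φ₀ a)_c = skeletonFn Φ₀ (a + c)`. [folklore] -/
theorem translateMulti_skeletonFn {K : ℕ} (Φ₀ : 𝓢((Fin K → EuclideanSpace ℝ (Fin d)), ℂ))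
    (a : Fin K → ℝ) (c : ℝ) :
    QuantumLattice.translateMulti (timeVec c) (skeletonFn Φ₀ a) =
      skeletonFn Φ₀ (fun j => a j + c) := by
  ext x
  simp only [QuantumLattice.translateMulti_apply, skeletonFn_apply]
  congr 1
  funext j
  rw [timeVec_add]
  abel

/-! ### Tensor products: splitting, adjoint, positivity -/

/-- **Splitting a tensor product over `n + m` points** into the appended tensor product of the
first `n` and the last `m` factors. [folklore] -/
theorem tensorFin_add {n m : ℕ} {E : Type*} [NormedAddCommGroup E] [NormedSpace ℝ E]
    (φ : Fin (n + m) → 𝓢(E, ℂ)) :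
    SchwartzMap.tensorFin (n + m) φ =
      (SchwartzMap.tensorFin n fun j => φ (Fin.castAdd m j)).appendTensor
        (SchwartzMap.tensorFin m fun j => φ (Fin.natAdd n j)) := by
  ext x
  simp only [SchwartzMap.tensorFin_apply, SchwartzMap.appendTensor_apply, Function.comp_apply]
  exact Fin.prod_univ_add _

/-- **Splitting a skeleton cluster** over `n + m` points. [folklore] -/
theorem skeletonFn_tensorFin_add {n m : ℕ} (φ : Fin (n + m) → 𝓢(EuclideanSpace ℝ (Fin d), ℂ))
    (a : Fin (n + m) → ℝ) :
    skeletonFn (SchwartzMap.tensorFin (n + m) φ) a =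
      (skeletonFn (SchwartzMap.tensorFin n fun j => φ (Fin.castAdd m j)) fun j => a (Fin.castAdd m j)).appendTensor
        (skeletonFn (SchwartzMap.tensorFin m fun j => φ (Fin.natAdd n j)) fun j => a (Fin.natAdd n j)) := by
  ext x
  simp only [skeletonFn_apply, SchwartzMap.tensorFin_apply, SchwartzMap.appendTensor_apply,
    Function.comp_apply]
  exact Fin.prod_univ_add _

/-- The **reflected profile** `ψ^θ(y) = conj ψ(θ y)` of a one-point test function (the
one-point OS adjoint). [folklore] -/
def reflectOne (ψ : 𝓢(EuclideanSpace ℝ (Fin d), ℂ)) : 𝓢(EuclideanSpace ℝ (Fin d), ℂ) :=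
  QuantumLattice.starTest (QuantumLattice.thetaTest d ψ)

/-- Values of the reflected profile. [folklore] -/
@[simp] theorem reflectOne_apply (ψ : 𝓢(EuclideanSpace ℝ (Fin d), ℂ)) (y : EuclideanSpace ℝ (Fin d)) :
    reflectOne ψ y = conj (ψ (QuantumLattice.timeReflection d y)) := by
  simp [reflectOne]

/-- `θ (y - t e₀) = θ y + t e₀`: reflecting a time-translate. [folklore] -/
theorem timeReflection_sub_timeVec (y : EuclideanSpace ℝ (Fin d)) (t : ℝ) :
    QuantumLattice.timeReflection d (y - timeVec t) =
      QuantumLattice.timeReflection d y - timeVec (-t) := by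
  rw [map_sub, timeReflection_timeVec]
  ext i
  simp only [timeVec, PiLp.sub_apply, PiLp.neg_apply, PiLp.single_apply]
  split_ifs <;> ring

/-- **The OS adjoint of a skeleton tensor cluster**: reversed order, reflected profiles, negated
skeleton times — `Θ(⊗ⱼ ψⱼ(· - aⱼe₀))* = ⊗ⱼ ψ^θ_{rev j}(· + a_{rev j} e₀)`. [folklore] -/
theorem osAdjoint_skeletonFn_tensorFin {K : ℕ} (ψ : Fin K → 𝓢(EuclideanSpace ℝ (Fin d), ℂ))
    (a : Fin K → ℝ) :
    QuantumLattice.osAdjoint (skeletonFn (SchwartzMap.tensorFin K ψ) a) =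
      skeletonFn (SchwartzMap.tensorFin K fun j => reflectOne (ψ (Fin.rev j))) fun j => -a (Fin.rev j) := by
  ext x
  simp only [QuantumLattice.osAdjoint_apply, skeletonFn_apply, SchwartzMap.tensorFin_apply, map_prod,
    reflectOne_apply]
  -- reindex the product along `rev`
  rw [← Equiv.prod_comp Fin.revPerm (fun j => conj (ψ j (QuantumLattice.timeReflection d (x (Fin.rev j)) -
    timeVec (a j))))]
  refine Finset.prod_congr rfl fun j _ => ?_
  simp only [Fin.revPerm_apply, Fin.rev_rev]
  rw [timeReflection_sub_timeVec, neg_neg]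

/-- The support of a tensor product lies over the supports of its factors. [folklore] -/
theorem apply_mem_tsupport_of_mem_tsupport_tensorFin {K : ℕ} {E : Type*} [NormedAddCommGroup E]
    [NormedSpace ℝ E] (φ : Fin K → 𝓢(E, ℂ)) {z : Fin K → E}
    (hz : z ∈ tsupport (SchwartzMap.tensorFin K φ : (Fin K → E) → ℂ)) (j : Fin K) :
    z j ∈ tsupport (φ j : E → ℂ) := by
  classical
  have hfun : (SchwartzMap.tensorFin K φ : (Fin K → E) → ℂ) =
      (fun z : Fin K → E => φ j (z j)) * fun z => ∏ i ∈ Finset.univ.erase j, φ i (z i) := by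
    funext z
    simp only [SchwartzMap.tensorFin_apply, Pi.mul_apply]
    rw [Finset.mul_prod_erase _ (fun i => φ i (z i)) (Finset.mem_univ j)]
  rw [hfun] at hz
  have h1 := tsupport_mul_subset_left hz
  exact tsupport_comp_subset_preimage (φ j : E → ℂ) (f := fun z : Fin K → E => z j) (continuous_apply j) h1

/-- **Positivity in time of a skeleton tensor cluster**: if every profile `φⱼ` is supported in
`{|y⁰| ≤ r}` and every skeleton time satisfies `r < aⱼ`, the cluster is positive-time. [folklore] -/
theorem isPositiveTimeMulti_skeletonFn_tensorFin {K : ℕ} {φ : Fin K → 𝓢(EuclideanSpace ℝ (Fin d), ℂ)}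
    {r : ℝ} (hφ : ∀ j, tsupport (φ j : EuclideanSpace ℝ (Fin d) → ℂ) ⊆ {y | |y 0| ≤ r})
    {a : Fin K → ℝ} (ha : ∀ j, r < a j) :
    IsPositiveTimeMulti (skeletonFn (SchwartzMap.tensorFin K φ) a) := by
  intro x hx j
  have hcont : Continuous fun y : Fin K → EuclideanSpace ℝ (Fin d) => fun i => y i - timeVec (a i) := by
    fun_prop
  have hfun : (skeletonFn (SchwartzMap.tensorFin K φ) a : (Fin K → EuclideanSpace ℝ (Fin d)) → ℂ) =
      (SchwartzMap.tensorFin K φ : (Fin K → EuclideanSpace ℝ (Fin d)) → ℂ) ∘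
        fun y : Fin K → EuclideanSpace ℝ (Fin d) => fun i => y i - timeVec (a i) := by
    funext y; rfl
  rw [hfun] at hx
  have hz := tsupport_comp_subset_preimage (SchwartzMap.tensorFin K φ : (Fin K → EuclideanSpace ℝ (Fin d)) → ℂ)
    hcont hx
  have hj := hφ j (apply_mem_tsupport_of_mem_tsupport_tensorFin φ hz j)
  have h0 : (timeVec (a j) : EuclideanSpace ℝ (Fin d)) 0 = a j := by simp [timeVec]
  simp only [mem_setOf_eq, PiLp.sub_apply, h0] at hj
  have h := ha j
  change 0 < x j 0
  rcases abs_le.1 hj with ⟨h1, -⟩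
  linarith

/-- The reflected profile has the time-reflected support: `|y⁰| ≤ r` is preserved. [folklore] -/
theorem tsupport_reflectOne_subset {ψ : 𝓢(EuclideanSpace ℝ (Fin d), ℂ)} {r : ℝ}
    (hψ : tsupport (ψ : EuclideanSpace ℝ (Fin d) → ℂ) ⊆ {y | |y 0| ≤ r}) :
    tsupport (reflectOne ψ : EuclideanSpace ℝ (Fin d) → ℂ) ⊆ {y | |y 0| ≤ r} := by
  intro y hy
  have hfun : (reflectOne ψ : EuclideanSpace ℝ (Fin d) → ℂ) =
      (fun c : ℂ => conj c) ∘ ((ψ : EuclideanSpace ℝ (Fin d) → ℂ) ∘ QuantumLattice.timeReflection d) := by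
    funext z; simp [reflectOne_apply]
  rw [hfun] at hy
  have h1 : y ∈ tsupport ((ψ : EuclideanSpace ℝ (Fin d) → ℂ) ∘ QuantumLattice.timeReflection d) :=
    tsupport_comp_subset (map_zero _) _ hy
  have h2 := tsupport_comp_subset_preimage (ψ : EuclideanSpace ℝ (Fin d) → ℂ)
    (QuantumLattice.timeReflection d).continuous h1
  have h3 := hψ h2
  simp only [mem_setOf_eq, QuantumLattice.timeReflection_apply] at h3 ⊢
  simpa using h3

/-! ### The two sub-clusters of a split skeleton cluster and the pairing identity -/

/-- The **left generator**: the OS adjoint of the first `n` points of a skeleton tensor cluster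
over `n + m` points (a positive-time function when those points sit at times `< -r`). [folklore] -/
def leftGenFn {n m : ℕ} (φ : Fin (n + m) → 𝓢(EuclideanSpace ℝ (Fin d), ℂ)) (a : Fin (n + m) → ℝ) :
    𝓢((Fin n → EuclideanSpace ℝ (Fin d)), ℂ) :=
  QuantumLattice.osAdjoint (skeletonFn (SchwartzMap.tensorFin n fun j => φ (Fin.castAdd m j))
    fun j => a (Fin.castAdd m j))

/-- The **right generator**: the last `m` points of a skeleton tensor cluster over `n + m` points,
pulled back in time by `t`. [folklore] -/
def rightGenFn {n m : ℕ} (φ : Fin (n + m) → 𝓢(EuclideanSpace ℝ (Fin d), ℂ)) (a : Fin (n + m) → ℝ)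
    (t : ℝ) : 𝓢((Fin m → EuclideanSpace ℝ (Fin d)), ℂ) :=
  skeletonFn (SchwartzMap.tensorFin m fun j => φ (Fin.natAdd n j)) fun j => a (Fin.natAdd n j) - t

/-- The left generator as a skeleton cluster of reflected profiles at negated, reversed times. [folklore] -/
theorem leftGenFn_eq {n m : ℕ} (φ : Fin (n + m) → 𝓢(EuclideanSpace ℝ (Fin d), ℂ)) (a : Fin (n + m) → ℝ) :
    leftGenFn φ a = skeletonFn (SchwartzMap.tensorFin n fun j => reflectOne (φ (Fin.castAdd m (Fin.rev j))))
      fun j => -a (Fin.castAdd m (Fin.rev j)) := by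
  rw [leftGenFn, osAdjoint_skeletonFn_tensorFin]

/-- **The left generator is positive-time** when the first `n` skeleton times are `< -r`. [folklore] -/
theorem isPositiveTimeMulti_leftGenFn {n m : ℕ} {φ : Fin (n + m) → 𝓢(EuclideanSpace ℝ (Fin d), ℂ)}
    {r : ℝ} (hφ : ∀ j, tsupport (φ j : EuclideanSpace ℝ (Fin d) → ℂ) ⊆ {y | |y 0| ≤ r})
    {a : Fin (n + m) → ℝ} (haL : ∀ j : Fin n, a (Fin.castAdd m j) < -r) :
    IsPositiveTimeMulti (leftGenFn φ a) := by
  rw [leftGenFn_eq]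
  exact isPositiveTimeMulti_skeletonFn_tensorFin (fun j => tsupport_reflectOne_subset (hφ _))
    fun j => by have h := haL (Fin.rev j); linarith

/-- **The right generator is positive-time** when the last `m` skeleton times are `> r + t`. [folklore] -/
theorem isPositiveTimeMulti_rightGenFn {n m : ℕ} {φ : Fin (n + m) → 𝓢(EuclideanSpace ℝ (Fin d), ℂ)}
    {r : ℝ} (hφ : ∀ j, tsupport (φ j : EuclideanSpace ℝ (Fin d) → ℂ) ⊆ {y | |y 0| ≤ r})
    {a : Fin (n + m) → ℝ} {t : ℝ} (haR : ∀ j : Fin m, r + t < a (Fin.natAdd n j)) :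
    IsPositiveTimeMulti (rightGenFn φ a t) :=
  isPositiveTimeMulti_skeletonFn_tensorFin (fun _ => hφ _) fun j => by have h := haR j; linarith

/-- Translating the right generator forward by `t` restores the right sub-cluster. [folklore] -/
theorem translateMulti_rightGenFn {n m : ℕ} (φ : Fin (n + m) → 𝓢(EuclideanSpace ℝ (Fin d), ℂ))
    (a : Fin (n + m) → ℝ) (t : ℝ) :
    QuantumLattice.translateMulti (timeVec t) (rightGenFn φ a t) =
      skeletonFn (SchwartzMap.tensorFin m fun j => φ (Fin.natAdd n j)) fun j => a (Fin.natAdd n j) := by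
  rw [rightGenFn, translateMulti_skeletonFn]
  congr 1
  funext j
  ring

/-- **The pairing identity for a split skeleton cluster**: with the first `n` skeleton times
`< -r` and the last `m` ones `> r + t`, `t ≥ 0` (`r` bounding the time supports of the profiles),
`𝔖_{n+m}(⊗ⱼ φⱼ(· - aⱼe₀)) = 𝔖_{n+m}(ΘP* ⊗ R_t) = genPairing (P) (shiftGen t R)` with the
positive-time generators `P = leftGenFn φ a`, `R = rightGenFn φ a t` — so that, by
`SchwingerFamily.gapContinuation_ofReal`, it is the value at `τ = t` of the holomorphic function
`τ ↦ ⟪v(P), e^{-τH} v(R)⟫` (Osterwalder–Schrader II (5.4)). [cite: OsterwalderSchraderCMP1975, Ch. V eq. (5.4)] -/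
theorem schwinger_skeletonFn_eq_genPairing (𝔖 : SchwingerFamily (EuclideanSpace ℝ (Fin d)))
    {n m : ℕ} {φ : Fin (n + m) → 𝓢(EuclideanSpace ℝ (Fin d), ℂ)} {r : ℝ}
    (hφ : ∀ j, tsupport (φ j : EuclideanSpace ℝ (Fin d) → ℂ) ⊆ {y | |y 0| ≤ r})
    {a : Fin (n + m) → ℝ} {t : ℝ} (ht : 0 ≤ t) (haL : ∀ j : Fin n, a (Fin.castAdd m j) < -r)
    (haR : ∀ j : Fin m, r + t < a (Fin.natAdd n j)) :
    𝔖 (n + m) (skeletonFn (SchwartzMap.tensorFin (n + m) φ) a) =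
      genPairing 𝔖 (mkGen (leftGenFn φ a) (isPositiveTimeMulti_leftGenFn hφ haL))
        (shiftGen t (mkGen (rightGenFn φ a t) (isPositiveTimeMulti_rightGenFn hφ haR))) := by
  rw [shiftGen_of_nonneg ht, genPairing_eq]
  change _ = 𝔖.osPairing (leftGenFn φ a) (QuantumLattice.translateMulti (timeVec t) (rightGenFn φ a t))
  rw [SchwingerFamily.osPairing, translateMulti_rightGenFn, leftGenFn, QuantumLattice.osAdjoint_osAdjoint,
    skeletonFn_tensorFin_add]

/-- **Transport along a decomposition `n + m = K`** of the number of points: the value of `𝔖_K` on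
a skeleton tensor cluster over `K` points is the value of `𝔖_{n+m}` on the same cluster with its
points relabelled along `Fin.cast` (definitional once `K` is substituted; this is the bookkeeping
that lets one split a fixed `K`-point skeleton at every position). [folklore] -/
theorem schwinger_skeletonFn_tensorFin_cast (𝔖 : SchwingerFamily (EuclideanSpace ℝ (Fin d)))
    {K n m : ℕ} (h : n + m = K) (φ : Fin K → 𝓢(EuclideanSpace ℝ (Fin d), ℂ)) (a : Fin K → ℝ) :
    𝔖 K (skeletonFn (SchwartzMap.tensorFin K φ) a) =
      𝔖 (n + m) (skeletonFn (SchwartzMap.tensorFin (n + m) fun j => φ (Fin.cast h j)) fun j => a (Fin.cast h j)) := by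
  subst h
  rfl

/-- **The pairing identity at an arbitrary split position** of a `K`-point skeleton tensor
cluster, `K = n + m`: combine `schwinger_skeletonFn_tensorFin_cast` with
`schwinger_skeletonFn_eq_genPairing`. [cite: OsterwalderSchraderCMP1975, Ch. V eq. (5.4)] -/
theorem schwinger_skeletonFn_eq_genPairing_cast (𝔖 : SchwingerFamily (EuclideanSpace ℝ (Fin d)))
    {K n m : ℕ} (h : n + m = K) {φ : Fin K → 𝓢(EuclideanSpace ℝ (Fin d), ℂ)} {r : ℝ}
    (hφ : ∀ j, tsupport (φ j : EuclideanSpace ℝ (Fin d) → ℂ) ⊆ {y | |y 0| ≤ r})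
    {a : Fin K → ℝ} {t : ℝ} (ht : 0 ≤ t) (haL : ∀ j : Fin n, a (Fin.cast h (Fin.castAdd m j)) < -r)
    (haR : ∀ j : Fin m, r + t < a (Fin.cast h (Fin.natAdd n j))) :
    𝔖 K (skeletonFn (SchwartzMap.tensorFin K φ) a) =
      genPairing 𝔖
        (mkGen (leftGenFn (fun j => φ (Fin.cast h j)) fun j => a (Fin.cast h j))
          (isPositiveTimeMulti_leftGenFn (fun _ => hφ _) haL))
        (shiftGen t (mkGen (rightGenFn (fun j => φ (Fin.cast h j)) (fun j => a (Fin.cast h j)) t)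
          (isPositiveTimeMulti_rightGenFn (fun _ => hφ _) haR))) := by
  rw [schwinger_skeletonFn_tensorFin_cast 𝔖 h]
  exact schwinger_skeletonFn_eq_genPairing 𝔖 (fun _ => hφ _) ht haL haR

end Literature.MathematicalPhysics.QuantumFieldTheory
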